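import Summits.MatrixMultiplication.MatrixMultiplication.Theorems.SoloInformedFamilyDoorGeneral
import Summits.MatrixMultiplication.MatrixMultiplication.Theorems.SoloInformedCarrierRank

/-!
# The window of the whole carrier family: `3 ≤ R̃(T_{P,Q,M}) ≤ R(T_{P,Q,M}) ≤ 5`, uniformly

Solo deliverable (informed mode). `SoloInformedCarrierRank` / `SoloInformedCarrierKoszul` computed
`R = R̲ = 5` for the class representatives `T_{H(μ)}` and `T_{Γ₂}` by explicit five-term
decompositions, and `SoloInformedCarrierFamily` the uniform floor `3 ≤ R̃(T_{P,Q,M})`. Here the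
CEILING is made uniform and classification-free, by transporting the two five-term decompositions
along explicit invertible basis changes (each an instance of `TensorRestrictsTo` checked entrywise):

* `cwShapeTensor_restrictsTo_lshear / _scale / _swap` (and `_shear` from `SoloInformedFamilyDoor`):
  `T_{1,1,M} ≥ T_{1,1,X′ᵀM′X′}`, `≥ T_{1,1,DM′D}`, `≥ T_{1,1,JM′J}`; `tensorRank_le_shear/lshear/swap`:
  the inverse moves, so `R(T_M) ≤ R(T_{op M})`.
* `tensorRank_antiDiag_le_five`, `tensorRank_cornerBlock_le_five`, `tensorRank_blockNormal_le_five`: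
  **`det M′ ≠ 0 ⇒ R(T_{1,1,M}) ≤ 5`** — complete the square to a zero-corner block `[[a,b],[c,0]]`;
  if `b + c ≠ 0` a lower shear kills `a` and a diagonal scaling reaches `H(c/b)`; if `b + c = 0 ≠ a`
  a diagonal scaling reaches `JΓ₂J`.
* `cwShapeTensor_restrictsTo_denormBlock`, `tensorRank_cwShape_le_five`,
  `asymptoticRank_cwShape_le_five`: the same for general blocks `(P, Q, M)`.

So every member's kernel window is `[3, 5]` and the door (`SoloInformedFamilyDoorGeneral`) asks for
its bottom value.
-/

noncomputable section

open scoped BigOperators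
open Literature.Computability.AlgebraicComplexity

namespace Summit.MatrixMultiplication.MatrixMultiplication.Theorems.CarrierFamily

/-! ## Uniform rank bound `R(T_{P,Q,M}) ≤ 5`, classification-free -/

/-- `T_{1,1,M}` only reads the inner block of `M`. [folklore] -/
theorem cwShapeTensor_one_one_congr {M N : Matrix (Fin 3) (Fin 3) ℂ} (h11 : M 1 1 = N 1 1)
    (h12 : M 1 2 = N 1 2) (h21 : M 2 1 = N 2 1) (h22 : M 2 2 = N 2 2) :
    cwShapeTensor 1 1 M = cwShapeTensor 1 1 N := by
  funext i j k
  fin_cases i <;> fin_cases j <;> fin_cases k <;> simp [cwShapeTensor, h11, h12, h21, h22]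

/-- Rank transport: if `T_N ≥ T_{M'}` and `M'` has the inner block of `M` then `R(T_M) ≤ R(T_N)`.
[folklore] -/
theorem tensorRank_le_of_restrictsTo_congr {M M' N : Matrix (Fin 3) (Fin 3) ℂ}
    (h : TensorRestrictsTo (cwShapeTensor 1 1 N) (cwShapeTensor 1 1 M')) (h11 : M' 1 1 = M 1 1)
    (h12 : M' 1 2 = M 1 2) (h21 : M' 2 1 = M 2 1) (h22 : M' 2 2 = M 2 2) :
    tensorRank (cwShapeTensor 1 1 M) ≤ tensorRank (cwShapeTensor 1 1 N) := by
  rw [cwShapeTensor_one_one_congr h11 h12 h21 h22] at h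
  exact h.tensorRank_le

/-- `R(T_{1,1,M}) ≤ R(T_{1,1,XᵀMX})` (the shear is invertible: shear back by `-x`). [folklore] -/
theorem tensorRank_le_shear (M : Matrix (Fin 3) (Fin 3) ℂ) (x : ℂ) :
    tensorRank (cwShapeTensor 1 1 M) ≤ tensorRank (cwShapeTensor 1 1 (shearBlock x M)) :=
  tensorRank_le_of_restrictsTo_congr (cwShapeTensor_restrictsTo_shear (shearBlock x M) (-x))
    (by simp [shearBlock]) (by simp [shearBlock]) (by simp [shearBlock])
    (by simp [shearBlock]; ring)

/-- The lower shear `M′ ↦ X′ᵀ M′ X′`, `X′ = [[1, 0], [t, 1]]`. [folklore] -/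
def lshearBlock (t : ℂ) (M : Matrix (Fin 3) (Fin 3) ℂ) : Matrix (Fin 3) (Fin 3) ℂ := fun i j =>
  if i = 1 ∧ j = 1 then M 1 1 + (M 1 2 + M 2 1) * t + M 2 2 * t ^ 2
  else if i = 1 ∧ j = 2 then M 1 2 + M 2 2 * t
  else if i = 2 ∧ j = 1 then M 2 1 + M 2 2 * t
  else if i = 2 ∧ j = 2 then M 2 2
  else 0

/-- **`T_{1,1,M} ≥ T_{1,1,X′ᵀMX′}`** for the lower shear (basis change
`(1 ⊕ X′, 1 ⊕ X′, 1 ⊕ X′⁻ᵀ)`). [cite: BurgisserClausenShokrollahi1997, (14.24)] -/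
theorem cwShapeTensor_restrictsTo_lshear (M : Matrix (Fin 3) (Fin 3) ℂ) (t : ℂ) :
    TensorRestrictsTo (cwShapeTensor 1 1 M) (cwShapeTensor 1 1 (lshearBlock t M)) := by
  refine ⟨fun a' a => !![(1 : ℂ), 0, 0; 0, 1, 0; 0, t, 1] a a',
    fun b' b => !![(1 : ℂ), 0, 0; 0, 1, 0; 0, t, 1] b b',
    fun c' c => !![(1 : ℂ), 0, 0; 0, 1, -t; 0, 0, 1] c c', fun a' b' c' => ?_⟩
  fin_cases a' <;> fin_cases b' <;> fin_cases c' <;>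
    simp [Fin.sum_univ_three, cwShapeTensor, lshearBlock] <;> ring

/-- `R(T_{1,1,M}) ≤ R(T_{1,1,X′ᵀMX′})`. [folklore] -/
theorem tensorRank_le_lshear (M : Matrix (Fin 3) (Fin 3) ℂ) (t : ℂ) :
    tensorRank (cwShapeTensor 1 1 M) ≤ tensorRank (cwShapeTensor 1 1 (lshearBlock t M)) :=
  tensorRank_le_of_restrictsTo_congr (cwShapeTensor_restrictsTo_lshear (lshearBlock t M) (-t))
    (by simp [lshearBlock]; ring) (by simp [lshearBlock])
    (by simp [lshearBlock]) (by simp [lshearBlock])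

/-- The diagonal scaling `M′ ↦ D M′ D`, `D = diag(s, t)`. [folklore] -/
def scaleBlock (s t : ℂ) (M : Matrix (Fin 3) (Fin 3) ℂ) : Matrix (Fin 3) (Fin 3) ℂ := fun i j =>
  if i = 1 ∧ j = 1 then s ^ 2 * M 1 1
  else if i = 1 ∧ j = 2 then s * t * M 1 2
  else if i = 2 ∧ j = 1 then s * t * M 2 1
  else if i = 2 ∧ j = 2 then t ^ 2 * M 2 2
  else 0

/-- **`T_{1,1,M} ≥ T_{1,1,DMD}`** for invertible `D = diag(s,t)` (basis change
`(1 ⊕ D, 1 ⊕ D, 1 ⊕ D⁻¹)`, written with `u s = 1`, `v t = 1`).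
[cite: BurgisserClausenShokrollahi1997, (14.24)] -/
theorem cwShapeTensor_restrictsTo_scale (M : Matrix (Fin 3) (Fin 3) ℂ) {s t u v : ℂ}
    (hu : u * s = 1) (hv : v * t = 1) :
    TensorRestrictsTo (cwShapeTensor 1 1 M) (cwShapeTensor 1 1 (scaleBlock s t M)) := by
  refine ⟨fun a' a => !![(1 : ℂ), 0, 0; 0, s, 0; 0, 0, t] a a',
    fun b' b => !![(1 : ℂ), 0, 0; 0, s, 0; 0, 0, t] b b',
    fun c' c => !![(1 : ℂ), 0, 0; 0, u, 0; 0, 0, v] c c', fun a' b' c' => ?_⟩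
  fin_cases a' <;> fin_cases b' <;> fin_cases c' <;>
    simp [Fin.sum_univ_three, cwShapeTensor, scaleBlock] <;>
    first
      | ring1
      | exact Or.inl (by ring)
      | linear_combination hu
      | linear_combination hv
      | linear_combination hu + hv
      | linear_combination 2 * hu
      | linear_combination 2 * hv
      | linear_combination (-1 : ℂ) * hu
      | linear_combination (-1 : ℂ) * hv

/-- The transposition of the inner indices `M′ ↦ J M′ J`. [folklore] -/
def swapBlock (M : Matrix (Fin 3) (Fin 3) ℂ) : Matrix (Fin 3) (Fin 3) ℂ := fun i j =>
  if i = 1 ∧ j = 1 then M 2 2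
  else if i = 1 ∧ j = 2 then M 2 1
  else if i = 2 ∧ j = 1 then M 1 2
  else if i = 2 ∧ j = 2 then M 1 1
  else 0

/-- **`T_{1,1,M} ≥ T_{1,1,JMJ}`** (basis change `(1 ⊕ J, 1 ⊕ J, 1 ⊕ J)`). [folklore] -/
theorem cwShapeTensor_restrictsTo_swap (M : Matrix (Fin 3) (Fin 3) ℂ) :
    TensorRestrictsTo (cwShapeTensor 1 1 M) (cwShapeTensor 1 1 (swapBlock M)) := by
  refine ⟨fun a' a => !![(1 : ℂ), 0, 0; 0, 0, 1; 0, 1, 0] a a',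
    fun b' b => !![(1 : ℂ), 0, 0; 0, 0, 1; 0, 1, 0] b b',
    fun c' c => !![(1 : ℂ), 0, 0; 0, 0, 1; 0, 1, 0] c c', fun a' b' c' => ?_⟩
  fin_cases a' <;> fin_cases b' <;> fin_cases c' <;>
    simp [Fin.sum_univ_three, cwShapeTensor, swapBlock]

/-- `R(T_{1,1,M}) ≤ R(T_{1,1,JMJ})`. [folklore] -/
theorem tensorRank_le_swap (M : Matrix (Fin 3) (Fin 3) ℂ) :
    tensorRank (cwShapeTensor 1 1 M) ≤ tensorRank (cwShapeTensor 1 1 (swapBlock M)) :=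
  tensorRank_le_of_restrictsTo_congr (cwShapeTensor_restrictsTo_swap (swapBlock M))
    (by simp [swapBlock]) (by simp [swapBlock]) (by simp [swapBlock]) (by simp [swapBlock])

/-- Anti-diagonal blocks `[[0,b],[c,0]]`, `bc ≠ 0`: `R(T_{1,1,M}) ≤ 5` — scale `H(c/b)` by
`D = diag(1, b)` and use the five-term decomposition of `T_{H(μ)}`. [folklore] -/
theorem tensorRank_antiDiag_le_five {M : Matrix (Fin 3) (Fin 3) ℂ} (h11 : M 1 1 = 0)
    (h22 : M 2 2 = 0) (h12 : M 1 2 ≠ 0) (h21 : M 2 1 ≠ 0) :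
    tensorRank (cwShapeTensor 1 1 M) ≤ 5 := by
  have hb : (M 1 2)⁻¹ * M 1 2 = 1 := inv_mul_cancel₀ h12
  have hμ : (M 1 2)⁻¹ * M 2 1 ≠ 0 := mul_ne_zero (inv_ne_zero h12) h21
  have hres := cwShapeTensor_restrictsTo_scale (hBlock ((M 1 2)⁻¹ * M 2 1)) (s := 1)
    (t := M 1 2) (u := 1) (v := (M 1 2)⁻¹) (one_mul 1) hb
  have hle := tensorRank_le_of_restrictsTo_congr (M := M) hres
    (by simp [scaleBlock, hBlock, h11]) (by simp [scaleBlock, hBlock])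
    (by simp [scaleBlock, hBlock]; linear_combination (M 2 1) * hb)
    (by simp [scaleBlock, hBlock, h22])
  refine hle.trans ?_
  rw [← hCarrier_eq_cwShapeTensor]
  exact WeightedLaser.tensorRank_hCarrier_le_five hμ

/-- `G′ = J Γ₂ J = [[1,1],[-1,0]]`: `R(T_{1,1,G′}) ≤ R(T_{Γ₂}) ≤ 5`. [folklore] -/
theorem tensorRank_swapGamma_le_five :
    tensorRank (cwShapeTensor 1 1 (swapBlock gammaBlock)) ≤ 5 :=
  (cwShapeTensor_restrictsTo_swap gammaBlock).tensorRank_le.trans tensorRank_gammaCarrier_le_five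

/-- Zero-corner blocks `[[a,b],[c,0]]`, `bc ≠ 0`: `R(T_{1,1,M}) ≤ 5`. If `b + c ≠ 0` a lower shear
kills `a`; if `b + c = 0 ≠ a` the block is `D G′ D` for a diagonal `D` (`G′ = JΓ₂J`). [folklore] -/
theorem tensorRank_cornerBlock_le_five {M : Matrix (Fin 3) (Fin 3) ℂ} (h22 : M 2 2 = 0)
    (h12 : M 1 2 ≠ 0) (h21 : M 2 1 ≠ 0) : tensorRank (cwShapeTensor 1 1 M) ≤ 5 := by
  by_cases hsum : M 1 2 + M 2 1 = 0
  · by_cases h11 : M 1 1 = 0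
    · exact tensorRank_antiDiag_le_five h11 h22 h12 h21
    · obtain ⟨w, hw⟩ := IsAlgClosed.exists_eq_mul_self (M 1 1)
      have hw0 : w ≠ 0 := by
        rintro rfl
        exact h11 (by rw [hw, mul_zero])
      have hu : w⁻¹ * w = 1 := inv_mul_cancel₀ hw0
      have hu0 : w⁻¹ * M 1 2 ≠ 0 := mul_ne_zero (inv_ne_zero hw0) h12
      have hv : (w⁻¹ * M 1 2)⁻¹ * (w⁻¹ * M 1 2) = 1 := inv_mul_cancel₀ hu0
      have hres := cwShapeTensor_restrictsTo_scale (swapBlock gammaBlock) (s := w)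
        (t := w⁻¹ * M 1 2) (u := w⁻¹) (v := (w⁻¹ * M 1 2)⁻¹) hu hv
      have hle := tensorRank_le_of_restrictsTo_congr (M := M) hres
        (by simp [scaleBlock, swapBlock, gammaBlock]; linear_combination (-1 : ℂ) * hw)
        (by simp [scaleBlock, swapBlock, gammaBlock]; linear_combination (M 1 2) * hu)
        (by simp [scaleBlock, swapBlock, gammaBlock]
            linear_combination (-(M 1 2)) * hu - hsum)
        (by simp [scaleBlock, swapBlock, gammaBlock, h22])
      exact hle.trans tensorRank_swapGamma_le_five
  · set t : ℂ := -(M 1 1) / (M 1 2 + M 2 1) with ht_def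
    have ht : (M 1 2 + M 2 1) * t = -(M 1 1) := by
      rw [ht_def]; field_simp
    refine (tensorRank_le_lshear M t).trans (tensorRank_antiDiag_le_five ?_ ?_ ?_ ?_)
    · simp [lshearBlock, h22]; linear_combination ht
    · simp [lshearBlock, h22]
    · simpa [lshearBlock, h22] using h12
    · simpa [lshearBlock, h22] using h21

/-- **`R(T_{1,1,M}) ≤ 5` for EVERY non-degenerate block**, with no classification of bilinear forms:
complete the square (shear to a zero-corner block), then `tensorRank_cornerBlock_le_five`.
[cite: ConnerGesmundoLandsbergVentura2022, §5] -/
theorem tensorRank_blockNormal_le_five {M : Matrix (Fin 3) (Fin 3) ℂ}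
    (hdet : (innerBlock M).det ≠ 0) : tensorRank (cwShapeTensor 1 1 M) ≤ 5 := by
  rw [det_innerBlock] at hdet
  by_cases h11 : M 1 1 = 0
  · have h12 : M 1 2 ≠ 0 := by
      intro h; apply hdet; rw [h11, h]; ring
    have h21 : M 2 1 ≠ 0 := by
      intro h; apply hdet; rw [h11, h]; ring
    by_cases h22 : M 2 2 = 0
    · exact tensorRank_antiDiag_le_five h11 h22 h12 h21
    · exact (tensorRank_le_swap M).trans (tensorRank_cornerBlock_le_five
        (by simp [swapBlock, h11]) (by simpa [swapBlock] using h21)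
        (by simpa [swapBlock] using h12))
  · obtain ⟨x, hx⟩ := exists_quadratic_eq_zero h11
      (IsAlgClosed.exists_eq_mul_self (discrim (M 1 1) (M 1 2 + M 2 1) (M 2 2)))
    obtain ⟨-, e12, e21, e22⟩ := shearBlock_entries x M
    refine (tensorRank_le_shear M x).trans (tensorRank_cornerBlock_le_five ?_ ?_ ?_)
    · rw [e22]
      linear_combination hx
    · rw [e12]
      intro h; apply hdet; linear_combination (M 1 1) * hx - (M 1 1 * x + M 2 1) * h
    · rw [e21]
      intro h; apply hdet; linear_combination (M 1 1) * hx - (M 1 1 * x + M 1 2) * h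

/-- The kernel window of every block-normal carrier: `3 ≤ R̃(T_{1,1,M}) ≤ R(T_{1,1,M}) ≤ 5`.
[cite: BurgisserClausenShokrollahi1997, Lemma (15.27)] -/
theorem asymptoticRank_blockNormal_le_five {M : Matrix (Fin 3) (Fin 3) ℂ}
    (hdet : (innerBlock M).det ≠ 0) : asymptoticRank (cwShapeTensor 1 1 M) ≤ 5 := by
  have h1 := asymptoticRank_le_algBorderRank (cwShapeTensor 1 1 M)
  have h2 : (algBorderRank (cwShapeTensor 1 1 M) : ℝ) ≤ (tensorRank (cwShapeTensor 1 1 M) : ℝ) := by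
    exact_mod_cast algBorderRank_le_tensorRank (cwShapeTensor 1 1 M)
  have h5 : (tensorRank (cwShapeTensor 1 1 M) : ℝ) ≤ 5 := by
    exact_mod_cast tensorRank_blockNormal_le_five hdet
  exact h1.trans (h2.trans h5)

/-! ## General blocks: `T_{1,1,N} ≥ T_{P,Q,M}` back from the normal form -/

/-- `Q′ N′ P′ᵀ` padded (inverse of the normalisation `normBlock`). [folklore] -/
def denormBlock (P Q N : Matrix (Fin 3) (Fin 3) ℂ) : Matrix (Fin 3) (Fin 3) ℂ := fun i j =>
  if i = 0 ∨ j = 0 then 0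
  else ∑ k, ∑ l, if k = 0 ∨ l = 0 then 0 else Q i k * N k l * P j l

/-- **`T_{1,1,N} ≥ T_{P,Q,Q′N′P′ᵀ}`** (basis change `(1 ⊕ Q′ᵀ, 1 ⊕ P′ᵀ, 1)`).
[cite: BurgisserClausenShokrollahi1997, (14.24)] -/
theorem cwShapeTensor_restrictsTo_denormBlock (P Q N : Matrix (Fin 3) (Fin 3) ℂ) :
    TensorRestrictsTo (cwShapeTensor 1 1 N) (cwShapeTensor P Q (denormBlock P Q N)) := by
  refine ⟨fun a' a => if a = 0 ∧ a' = 0 then 1 else if a ≠ 0 ∧ a' ≠ 0 then Q a' a else 0,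
    fun b' b => if b = 0 ∧ b' = 0 then 1 else if b ≠ 0 ∧ b' ≠ 0 then P b' b else 0,
    fun c' c => if c = c' then 1 else 0, fun a' b' c' => ?_⟩
  fin_cases a' <;> fin_cases b' <;> fin_cases c' <;>
    simp [Fin.sum_univ_three, cwShapeTensor, denormBlock] <;> ring

/-- `Q′ (Q′⁻¹ M′ P′⁻ᵀ) P′ᵀ = M′` entrywise (with `e det P′ = 1`, `f det Q′ = 1`). [folklore] -/
theorem denormBlock_normBlock (P Q M : Matrix (Fin 3) (Fin 3) ℂ) {e f : ℂ}
    (he : e * (P 1 1 * P 2 2 - P 1 2 * P 2 1) = 1)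
    (hf : f * (Q 1 1 * Q 2 2 - Q 1 2 * Q 2 1) = 1) :
    denormBlock P Q (normBlock P Q M e f) 1 1 = M 1 1 ∧
      denormBlock P Q (normBlock P Q M e f) 1 2 = M 1 2 ∧
      denormBlock P Q (normBlock P Q M e f) 2 1 = M 2 1 ∧
      denormBlock P Q (normBlock P Q M e f) 2 2 = M 2 2 := by
  refine ⟨?_, ?_, ?_, ?_⟩ <;> simp [denormBlock, normBlock, adjTBlock, Fin.sum_univ_three]
  · linear_combination (M 1 1 * (f * (Q 1 1 * Q 2 2 - Q 1 2 * Q 2 1))) * he + (M 1 1) * hf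
  · linear_combination (M 1 2 * (f * (Q 1 1 * Q 2 2 - Q 1 2 * Q 2 1))) * he + (M 1 2) * hf
  · linear_combination (M 2 1 * (f * (Q 1 1 * Q 2 2 - Q 1 2 * Q 2 1))) * he + (M 2 1) * hf
  · linear_combination (M 2 2 * (f * (Q 1 1 * Q 2 2 - Q 1 2 * Q 2 1))) * he + (M 2 2) * hf

/-- **`R(T_{P,Q,M}) ≤ 5` for ALL non-degenerate `P, Q, M`** — the uniform upper end of the window
of the carrier family, without any classification. [cite: ConnerGesmundoLandsbergVentura2022, §5] -/
theorem tensorRank_cwShape_le_five {P Q M : Matrix (Fin 3) (Fin 3) ℂ}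
    (hP : (innerBlock P).det ≠ 0) (hQ : (innerBlock Q).det ≠ 0) (hM : (innerBlock M).det ≠ 0) :
    tensorRank (cwShapeTensor P Q M) ≤ 5 := by
  set e : ℂ := ((innerBlock P).det)⁻¹ with he_def
  set f : ℂ := ((innerBlock Q).det)⁻¹ with hf_def
  have he : e * (innerBlock P).det = 1 := inv_mul_cancel₀ hP
  have hf : f * (innerBlock Q).det = 1 := inv_mul_cancel₀ hQ
  have he' : e * (P 1 1 * P 2 2 - P 1 2 * P 2 1) = 1 := by rwa [det_innerBlock] at he
  have hf' : f * (Q 1 1 * Q 2 2 - Q 1 2 * Q 2 1) = 1 := by rwa [det_innerBlock] at hf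
  have hN : (innerBlock (normBlock P Q M e f)).det ≠ 0 := by
    rw [det_innerBlock_normBlock, he, hf, one_mul, one_mul]
    refine mul_ne_zero (mul_ne_zero ?_ ?_) hM
    · exact inv_ne_zero hP
    · exact inv_ne_zero hQ
  obtain ⟨e11, e12, e21, e22⟩ := denormBlock_normBlock P Q M he' hf'
  have hres := cwShapeTensor_restrictsTo_denormBlock P Q (normBlock P Q M e f)
  have hcongr :
      cwShapeTensor P Q (denormBlock P Q (normBlock P Q M e f)) = cwShapeTensor P Q M := by
    funext i j k
    fin_cases i <;> fin_cases j <;> fin_cases k <;> simp [cwShapeTensor, e11, e12, e21, e22]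
  rw [hcongr] at hres
  exact hres.tensorRank_le.trans (tensorRank_blockNormal_le_five hN)

/-- **The kernel window of EVERY member of the family: `3 ≤ R̃(T_{P,Q,M}) ≤ 5`** (lower end
`three_le_asymptoticRank_cwShapeTensor`); the door asks for the bottom value `3`.
[cite: BurgisserClausenShokrollahi1997, Lemma (15.27)] -/
theorem asymptoticRank_cwShape_le_five {P Q M : Matrix (Fin 3) (Fin 3) ℂ}
    (hP : (innerBlock P).det ≠ 0) (hQ : (innerBlock Q).det ≠ 0) (hM : (innerBlock M).det ≠ 0) :
    asymptoticRank (cwShapeTensor P Q M) ≤ 5 := by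
  have h1 := asymptoticRank_le_algBorderRank (cwShapeTensor P Q M)
  have h2 : (algBorderRank (cwShapeTensor P Q M) : ℝ) ≤ (tensorRank (cwShapeTensor P Q M) : ℝ) := by
    exact_mod_cast algBorderRank_le_tensorRank (cwShapeTensor P Q M)
  have h5 : (tensorRank (cwShapeTensor P Q M) : ℝ) ≤ 5 := by
    exact_mod_cast tensorRank_cwShape_le_five hP hQ hM
  exact h1.trans (h2.trans h5)


end Summit.MatrixMultiplication.MatrixMultiplication.Theorems.CarrierFamily

end
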